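import Literature.MathematicalPhysics.QuantumLattice.HeisenbergOrderNeelWindowDictionary

/-!
# A reflective nonnegativity checker for rational polynomials on intervals (D39 support)

HONEST FRAMING. 'ladder R1–R4 with certified numbers; no claim on H/H₀'.  Pure real-analysis
bookkeeping, [folklore]; no physics.  Used by the window-majorant Néel sign theorems
(`NeelSign*.lean`) to replace thousands of lines of expanded Bernstein identities by ONE
kernel evaluation (`decide +kernel`) of a verified checker.

* `peval p x` — Horner evaluation at a real point of a dense coefficient list `p : List ℚ`
  (low degree first).
* `certPos p lo hi = true` ⟹ `0 ≤ peval p s` for `lo ≤ s ≤ hi` (`certPos_sound`): the checker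
  Taylor-shifts `p` to the midpoint `m` and tests `p(m) - Σ_{k ≥ 1} |p^{(k)}(m)/k!| r^k ≥ 0`,
  `r = (hi-lo)/2`, in exact rational arithmetic.
* `certFibers lo hi sb oks A B` checks, for paired lists of polynomials `aᵢ, bᵢ`, that on
  `[lo, hi]`: `aᵢ ≥ 0` and (`bᵢ ≥ 0` or `aᵢ + sb·bᵢ ≥ 0` or `aᵢ²(2+s) - bᵢ²(2-s) ≥ 0`); with
  `σ(s) = √((2-s)/(2+s)) ≤ sb` on the piece (guaranteed by `okS lo sb`) each alternative gives
  `aᵢ + σ bᵢ ≥ 0` (`fiberOK_of_certFibers`).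
* `certCover` chains pieces over an interval; `cover_sound` is the statement used by the kernels.
-/

namespace Summit.HubbardSuperconductivity.HubbardLadder.PolyCert

/-- Horner evaluation of a dense rational coefficient list (low → high) at a real point. -/
def peval : List ℚ → ℝ → ℝ
  | [], _ => 0
  | c :: cs, x => (c : ℝ) + x * peval cs x

/-- Auxiliary lemma `peval_nil` (support step for the results of this file; see the module docstring). -/
@[simp] theorem peval_nil (x : ℝ) : peval [] x = 0 := rfl
/-- Auxiliary lemma `peval_cons` (support step for the results of this file; see the module docstring). -/
@[simp] theorem peval_cons (c : ℚ) (cs : List ℚ) (x : ℝ) :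
    peval (c :: cs) x = (c : ℝ) + x * peval cs x := rfl

/-- Add a constant to the constant coefficient. -/
def addConst (c : ℚ) : List ℚ → List ℚ
  | [] => [c]
  | d :: ds => (c + d) :: ds

/-- Auxiliary lemma `peval_addConst` (support step for the results of this file; see the module docstring). -/
theorem peval_addConst (c : ℚ) (p : List ℚ) (x : ℝ) :
    peval (addConst c p) x = c + peval p x := by
  cases p with
  | nil => simp [addConst]
  | cons d ds => simp [addConst]; ring

/-- Coefficients of `(X + m) · p`. -/
def mulLin (m : ℚ) : List ℚ → List ℚ
  | [] => []
  | c :: cs => (m * c) :: addConst c (mulLin m cs)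

/-- Auxiliary lemma `peval_mulLin` (support step for the results of this file; see the module docstring). -/
theorem peval_mulLin (m : ℚ) (p : List ℚ) (x : ℝ) :
    peval (mulLin m p) x = (x + m) * peval p x := by
  induction p with
  | nil => simp [mulLin]
  | cons c cs ih => simp [mulLin, peval_addConst, ih]; ring

/-- Taylor shift: coefficients of `t ↦ p(m + t)`. -/
def shift (m : ℚ) : List ℚ → List ℚ
  | [] => []
  | c :: cs => addConst c (mulLin m (shift m cs))

/-- Auxiliary lemma `peval_shift` (support step for the results of this file; see the module docstring). -/
theorem peval_shift (m : ℚ) (p : List ℚ) (t : ℝ) :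
    peval (shift m p) t = peval p (m + t) := by
  induction p with
  | nil => simp [shift]
  | cons c cs ih =>
    simp only [shift, peval_addConst, peval_mulLin, ih, peval_cons]
    ring

/-- `Σ |c_k| r^k` (Horner). -/
def absEval : List ℚ → ℚ → ℚ
  | [], _ => 0
  | c :: cs, r => |c| + r * absEval cs r

/-- Auxiliary lemma `absEval_nonneg` (support step for the results of this file; see the module docstring). -/
theorem absEval_nonneg (p : List ℚ) {r : ℚ} (hr : 0 ≤ r) : 0 ≤ absEval p r := by
  induction p with
  | nil => simp [absEval]
  | cons c cs ih => simp only [absEval]; positivity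

/-- Auxiliary lemma `abs_peval_le` (support step for the results of this file; see the module docstring). -/
theorem abs_peval_le (p : List ℚ) {r : ℚ} (hr : 0 ≤ r) {t : ℝ} (ht : |t| ≤ r) :
    |peval p t| ≤ (absEval p r : ℝ) := by
  induction p with
  | nil => simp [absEval]
  | cons c cs ih =>
    simp only [peval_cons, absEval]
    push_cast
    have h1 : |(c : ℝ) + t * peval cs t| ≤ |(c : ℝ)| + |t| * |peval cs t| := by
      calc |(c : ℝ) + t * peval cs t| ≤ |(c : ℝ)| + |t * peval cs t| := abs_add_le _ _
        _ = |(c : ℝ)| + |t| * |peval cs t| := by rw [abs_mul]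
    have h2 : |t| * |peval cs t| ≤ (r : ℝ) * (absEval cs r : ℝ) :=
      mul_le_mul ht ih (abs_nonneg _) (by exact_mod_cast hr)
    have h3 : |(c : ℝ)| = ((|c| : ℚ) : ℝ) := (Rat.cast_abs c).symm
    linarith

/-- Lower bound of `p` on `[m - r, m + r]`. -/
def lowerBound (p : List ℚ) (m r : ℚ) : ℚ :=
  match shift m p with
  | [] => 0
  | c :: cs => c - r * absEval cs r

/-- Auxiliary lemma `lowerBound_le` (support step for the results of this file; see the module docstring). -/
theorem lowerBound_le (p : List ℚ) (m r : ℚ) (hr : 0 ≤ r) {s : ℝ} (h1 : (m : ℝ) - r ≤ s)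
    (h2 : s ≤ m + r) : (lowerBound p m r : ℝ) ≤ peval p s := by
  have ht : |s - m| ≤ r := abs_le.mpr ⟨by linarith, by linarith⟩
  have e : peval p s = peval (shift m p) (s - m) := by rw [peval_shift]; ring_nf
  rw [e]
  unfold lowerBound
  rcases hq : shift m p with _ | ⟨c, cs⟩
  · simp
  · simp only [peval_cons]
    push_cast
    have hb := abs_peval_le cs hr ht
    have hA : 0 ≤ (absEval cs r : ℝ) := by exact_mod_cast absEval_nonneg cs hr
    have h3 : -((r : ℝ) * absEval cs r) ≤ (s - m) * peval cs (s - m) := by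
      have h4 := neg_abs_le ((s - m) * peval cs (s - m))
      rw [abs_mul] at h4
      have h5 : |s - m| * |peval cs (s - m)| ≤ r * absEval cs r :=
        mul_le_mul ht hb (abs_nonneg _) (by exact_mod_cast hr)
      linarith
    linarith

/-- The certificate: the midpoint Taylor lower bound is nonnegative. -/
def certPos (p : List ℚ) (lo hi : ℚ) : Bool :=
  decide (0 ≤ lowerBound p ((lo + hi) / 2) ((hi - lo) / 2))

/-- Auxiliary lemma `certPos_sound` (support step for the results of this file; see the module docstring). -/
theorem certPos_sound {p : List ℚ} {lo hi : ℚ} (h : certPos p lo hi = true) {s : ℝ}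
    (h1 : (lo : ℝ) ≤ s) (h2 : s ≤ hi) : 0 ≤ peval p s := by
  have h0 : (0 : ℚ) ≤ lowerBound p ((lo + hi) / 2) ((hi - lo) / 2) := of_decide_eq_true h
  have hle : (lo : ℝ) ≤ hi := h1.trans h2
  have hr : (0 : ℚ) ≤ (hi - lo) / 2 := by
    have : (lo : ℚ) ≤ hi := by exact_mod_cast hle
    linarith
  have hb := lowerBound_le p ((lo + hi) / 2) ((hi - lo) / 2) hr (s := s)
    (by push_cast; linarith) (by push_cast; linarith)
  have h0' : (0 : ℝ) ≤ (lowerBound p ((lo + hi) / 2) ((hi - lo) / 2) : ℝ) := by exact_mod_cast h0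
  linarith

/-- Coefficientwise sum. -/
def padd : List ℚ → List ℚ → List ℚ
  | [], q => q
  | p, [] => p
  | c :: cs, d :: ds => (c + d) :: padd cs ds

/-- Auxiliary lemma `peval_padd` (support step for the results of this file; see the module docstring). -/
theorem peval_padd (p q : List ℚ) (x : ℝ) : peval (padd p q) x = peval p x + peval q x := by
  induction p generalizing q with
  | nil => simp [padd]
  | cons c cs ih =>
    cases q with
    | nil => simp [padd]
    | cons d ds => simp [padd, ih]; ring

/-- Scalar multiple. -/
def pscale (a : ℚ) : List ℚ → List ℚ
  | [] => []
  | c :: cs => (a * c) :: pscale a cs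

/-- Auxiliary lemma `peval_pscale` (support step for the results of this file; see the module docstring). -/
theorem peval_pscale (a : ℚ) (p : List ℚ) (x : ℝ) : peval (pscale a p) x = a * peval p x := by
  induction p with
  | nil => simp [pscale]
  | cons c cs ih => simp [pscale, ih]; ring

/-- Product. -/
def pmul : List ℚ → List ℚ → List ℚ
  | [], _ => []
  | c :: cs, q => padd (pscale c q) (0 :: pmul cs q)

/-- Auxiliary lemma `peval_pmul` (support step for the results of this file; see the module docstring). -/
theorem peval_pmul (p q : List ℚ) (x : ℝ) : peval (pmul p q) x = peval p x * peval q x := by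
  induction p with
  | nil => simp [pmul]
  | cons c cs ih => simp [pmul, peval_padd, peval_pscale, ih]; ring

/-- `a²(2+s) - b²(2-s)` as a coefficient list. -/
def qpoly (a b : List ℚ) : List ℚ :=
  padd (pmul (pmul a a) [2, 1]) (pscale (-1) (pmul (pmul b b) [2, -1]))

/-- Auxiliary lemma `peval_qpoly` (support step for the results of this file; see the module docstring). -/
theorem peval_qpoly (a b : List ℚ) (s : ℝ) :
    peval (qpoly a b) s = peval a s ^ 2 * (2 + s) - peval b s ^ 2 * (2 - s) := by
  simp [qpoly, peval_padd, peval_pmul, peval_pscale]; ring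

/-- `sb` is an upper bound of `σ(s) = √((2-s)/(2+s))` for every `s ≥ lo` (`lo > -2`). -/
def okS (lo sb : ℚ) : Bool :=
  decide (0 ≤ sb) && decide (-2 < lo) && decide (2 - lo ≤ sb * sb * (2 + lo))

/-- Auxiliary lemma `sqrt_le_of_okS` (support step for the results of this file; see the module docstring). -/
theorem sqrt_le_of_okS {lo sb : ℚ} (h : okS lo sb = true) {s : ℝ} (hs : (lo : ℝ) ≤ s) :
    Real.sqrt ((2 - s) / (2 + s)) ≤ sb := by
  simp only [okS, Bool.and_eq_true, decide_eq_true_eq] at h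
  obtain ⟨⟨h0, h1⟩, h2⟩ := h
  have h1' : (-2 : ℝ) < lo := by exact_mod_cast h1
  have h2' : (2 : ℝ) - lo ≤ sb * sb * (2 + lo) := by exact_mod_cast h2
  have h0' : (0 : ℝ) ≤ sb := by exact_mod_cast h0
  have hpos : (0 : ℝ) < 2 + s := by linarith
  have hfrac : (2 - s) / (2 + s) ≤ (sb : ℝ) ^ 2 := by
    rw [div_le_iff₀ hpos]
    nlinarith [mul_nonneg (mul_self_nonneg (sb : ℝ)) (sub_nonneg.mpr hs)]
  calc Real.sqrt ((2 - s) / (2 + s)) ≤ Real.sqrt ((sb : ℝ) ^ 2) := Real.sqrt_le_sqrt hfrac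
    _ = sb := Real.sqrt_sq h0'

/-- The fiber conclusions for paired coefficient polynomials. -/
def FiberOK (σ s : ℝ) : List (List ℚ) → List (List ℚ) → Prop
  | [], _ => True
  | _ :: _, [] => True
  | a :: as, b :: bs => (0 ≤ peval a s ∧ 0 ≤ peval a s + σ * peval b s) ∧ FiberOK σ s as bs

/-- Auxiliary lemma `FiberOK_nil` (support step for the results of this file; see the module docstring). -/
@[simp] theorem FiberOK_nil (σ s : ℝ) (B : List (List ℚ)) : FiberOK σ s [] B = True := by
  cases B <;> rfl
/-- Auxiliary lemma `FiberOK_cons` (support step for the results of this file; see the module docstring). -/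
@[simp] theorem FiberOK_cons (σ s : ℝ) (a b : List ℚ) (as bs : List (List ℚ)) :
    FiberOK σ s (a :: as) (b :: bs) =
      ((0 ≤ peval a s ∧ 0 ≤ peval a s + σ * peval b s) ∧ FiberOK σ s as bs) := rfl

/-- Per-piece check of the fiber conditions. -/
def certFibers (lo hi sb : ℚ) (oks : Bool) : List (List ℚ) → List (List ℚ) → Bool
  | [], [] => true
  | [], _ :: _ => false
  | _ :: _, [] => false
  | a :: as, b :: bs =>
    (certPos a lo hi &&
      (certPos b lo hi || ((oks && certPos (padd a (pscale sb b)) lo hi) ||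
        certPos (qpoly a b) lo hi))) && certFibers lo hi sb oks as bs

/-- Auxiliary lemma `fiberOK_of_certFibers` (support step for the results of this file; see the module docstring). -/
theorem fiberOK_of_certFibers {lo hi sb : ℚ} {oks : Bool} {σ s : ℝ} (h1 : (lo : ℝ) ≤ s)
    (h2 : s ≤ hi) (hσ0 : 0 ≤ σ) (hσS : oks = true → σ ≤ sb)
    (hσQ : ∀ a b : ℝ, 0 ≤ a → 0 ≤ a ^ 2 * (2 + s) - b ^ 2 * (2 - s) → 0 ≤ a + σ * b) :
    ∀ (A B : List (List ℚ)), certFibers lo hi sb oks A B = true → FiberOK σ s A B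
  | [], [], _ => trivial
  | [], _ :: _, h => by simp [certFibers] at h
  | _ :: _, [], h => by simp [certFibers] at h
  | a :: as, b :: bs, h => by
    simp only [certFibers, Bool.and_eq_true, Bool.or_eq_true] at h
    obtain ⟨⟨ha, hb⟩, hrest⟩ := h
    have ha' := certPos_sound ha h1 h2
    refine ⟨⟨ha', ?_⟩, fiberOK_of_certFibers h1 h2 hσ0 hσS hσQ as bs hrest⟩
    rcases hb with hb | ⟨hok, hc⟩ | hq
    · exact add_nonneg ha' (mul_nonneg hσ0 (certPos_sound hb h1 h2))
    · have hc' := certPos_sound hc h1 h2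
      rw [peval_padd, peval_pscale] at hc'
      have hsb := hσS hok
      rcases le_or_gt 0 (peval b s) with hb0 | hb0
      · exact add_nonneg ha' (mul_nonneg hσ0 hb0)
      · nlinarith [mul_le_mul_of_nonpos_right hsb hb0.le]
    · have hq' := certPos_sound hq h1 h2
      rw [peval_qpoly] at hq'
      exact hσQ _ _ ha' hq'

/-- Contiguity + per-piece certificates for a list of pieces `(lo, hi, sb)` tiling `[lo0, hi0]`. -/
def certCover (A B : List (List ℚ)) (hi0 : ℚ) : ℚ → List (ℚ × ℚ × ℚ) → Bool
  | l0, [] => decide (l0 = hi0)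
  | l0, (pl, ph, psb) :: ps =>
    decide (pl = l0) && decide (pl ≤ ph) && certFibers pl ph psb (okS pl psb) A B &&
      certCover A B hi0 ph ps

/-- Auxiliary lemma `cover_sound_aux` (support step for the results of this file; see the module docstring). -/
theorem cover_sound_aux (A B : List (List ℚ)) (hi0 : ℚ) {σ s : ℝ} (hσ0 : 0 ≤ σ)
    (hσS : ∀ lo sb : ℚ, okS lo sb = true → (lo : ℝ) ≤ s → σ ≤ sb)
    (hσQ : ∀ a b : ℝ, 0 ≤ a → 0 ≤ a ^ 2 * (2 + s) - b ^ 2 * (2 - s) → 0 ≤ a + σ * b)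
    (hs2 : s ≤ hi0) :
    ∀ (ps : List (ℚ × ℚ × ℚ)) (lo0 : ℚ), certCover A B hi0 lo0 ps = true → (lo0 : ℝ) < s →
      FiberOK σ s A B := by
  intro ps
  induction ps with
  | nil =>
    intro lo0 h hs1
    simp only [certCover, decide_eq_true_eq] at h
    have : (lo0 : ℝ) = hi0 := by exact_mod_cast h
    linarith
  | cons p ps ih =>
    intro lo0 h hs1
    obtain ⟨pl, ph, psb⟩ := p
    simp only [certCover, Bool.and_eq_true, decide_eq_true_eq] at h
    obtain ⟨⟨⟨hlo, _⟩, hp⟩, hrest⟩ := h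
    have hs1' : (pl : ℝ) ≤ s := by rw [hlo]; exact hs1.le
    rcases le_or_gt s ph with hsh | hsh
    · exact fiberOK_of_certFibers hs1' hsh hσ0 (fun hok => hσS pl psb hok hs1') hσQ A B hp
    · exact ih ph hrest hsh

/-- **Soundness of the chained certificate** on `[lo0, hi0]`. [folklore] -/
theorem cover_sound (A B : List (List ℚ)) (hi0 : ℚ) {σ s : ℝ} (hσ0 : 0 ≤ σ)
    (hσS : ∀ lo sb : ℚ, okS lo sb = true → (lo : ℝ) ≤ s → σ ≤ sb)
    (hσQ : ∀ a b : ℝ, 0 ≤ a → 0 ≤ a ^ 2 * (2 + s) - b ^ 2 * (2 - s) → 0 ≤ a + σ * b)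
    (hs2 : s ≤ hi0) (ps : List (ℚ × ℚ × ℚ)) (hne : ps ≠ []) (lo0 : ℚ)
    (h : certCover A B hi0 lo0 ps = true) (hs1 : (lo0 : ℝ) ≤ s) : FiberOK σ s A B := by
  rcases hs1.lt_or_eq with hlt | heq
  · exact cover_sound_aux A B hi0 hσ0 hσS hσQ hs2 ps lo0 h hlt
  · cases ps with
    | nil => exact absurd rfl hne
    | cons p ps =>
      obtain ⟨pl, ph, psb⟩ := p
      simp only [certCover, Bool.and_eq_true, decide_eq_true_eq] at h
      obtain ⟨⟨⟨hlo, hle⟩, hp⟩, _⟩ := h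
      have hs1' : (pl : ℝ) ≤ s := by rw [hlo, heq]
      have hsh : s ≤ ph := by rw [← heq, ← hlo]; exact_mod_cast hle
      exact fiberOK_of_certFibers hs1' hsh hσ0 (fun hok => hσS pl psb hok hs1') hσQ A B hp

/-- demo: `x² - x + 1 ≥ 0` on `[0, 1]`, two pieces, evaluated by the kernel. -/
example : certCover [[(1:ℚ), -1, 1]] [[0]] 1 0 [(0, 1/2, 2), (1/2, 1, 2)] = true := by
  decide +kernel

end Summit.HubbardSuperconductivity.HubbardLadder.PolyCert
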